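import Literature.RingTheory.GradedAlgebra.MacaulayRepresentation
import Literature.RingTheory.MvPolynomial.MacaulayCompression
import Literature.RingTheory.MvPolynomial.MacaulayBoundProofs
import Literature.RingTheory.MvPolynomial.HilbertPolynomialExists
import Literature.RingTheory.HilbertSamuel.HilbertFunctionsNoetherian
import HarnessLib

/-!
# Macaulay's theorem on Hilbert functions: `H(R, d+1) ≤ H(R, d)^⟨d⟩` (Bruns–Herzog Thm. 4.2.10 (c))

Topic: `Literature/RingTheory/MvPolynomial`. For a homogeneous ideal `I` of
`S = K[X_0, …, X_{n-1}]` over an arbitrary field `K` and `R = S/I`, the Hilbert function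
`H(R, d) = dim_K S_d - dim_K I_d` (`Literature.RingTheory.HilbertSamuel.hilbertFunQuot`) satisfies
**Macaulay's bound** `H(R, d + 1) ≤ H(R, d)^⟨d⟩` for every `d ≥ 1` (Bruns–Herzog, *Cohen–Macaulay
rings*, Thm. 4.2.10, implication (a) ⇒ (c); `a^⟨d⟩ = Macaulay.upper d a` of
`GradedAlgebra/MacaulayRepresentation.lean`).

The proof assembled here is the combinatorial one (field-free), from pieces already in the tree:
* `H(S/I) = F(E(I))`, the Hilbert function of the monomial ideal of leading exponents
  (`hilbertFunQuot_eq_upperSetHilbertFun`, `HilbertSamuel/HilbertFunctionsNoetherian.lean`), so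
  that `H(R, d) = #Mon_d - #E_d` and `E_{d+1} ⊇ ∇E_d` (upper shadow);
* Macaulay's theorem on lex segments (`Macaulay.card_shadow_le_of_isLexSeg`,
  `MacaulayCompression.lean`: a lex segment has the least upper shadow among all families of
  degree-`d` monomials of at least its size; Miller–Sturmfels Thm. 2.22), and `isLexSeg_shadow`;
* NEW here — Bruns–Herzog Lemma 4.2.5 / Prop. 4.2.8 in the conventions of
  `MacaulayLexSegments.lean` (`x_0` most significant, lex segments = upper sets): for the
  complement `ℒ_u = {v ∈ Mon_d : v < u}` of a lex segment, **`|ℒ_{u · x_{n-1}}| = |ℒ_u|^⟨d⟩`**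
  (`card_below_add_e_last`), proved by induction on the number of variables through the
  first-coordinate recursion `|ℒ_{(c₀, u')}| = Σ_{c < c₀} #Mon_{d-c}(n-1) + |ℒ_{u'}|` and the
  uniqueness of Macaulay representations (`Macaulay.IsRep.upper_eq`); whence
  `#Mon_{d+1} - #∇L = (#Mon_d - #L)^⟨d⟩` for every lex segment `L ⊆ Mon_d`, `d ≥ 1`
  (`card_Mon_succ_sub_card_shadow`, Bruns–Herzog Cor. 4.2.9).

Main statements: `upperSetHilbertFun_succ_le_upper` (monomial ideals / upper sets of exponents)
and **`hilbertFunQuot_succ_le_upper`** (homogeneous ideals; Macaulay's theorem, (a) ⇒ (c)).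
Not here: the converse (c) ⇒ (a) via lexsegment ideals, Cor. 4.2.14, Gotzmann's theorems.

## References

* W. Bruns, J. Herzog, *Cohen–Macaulay rings*, rev. ed. (1998), Lemma 4.2.5, Prop. 4.2.8,
  Cor. 4.2.9, Thm. 4.2.10. [BrunsHerzog1998]
* E. Miller, B. Sturmfels, *Combinatorial Commutative Algebra*, GTM 227 (2005), Thm. 2.22
  (through `MacaulayCompression.lean`). [MillerSturmfels2005]
-/

noncomputable section

open Finset Literature.RingTheory.GradedAlgebra.Macaulay

namespace Literature.RingTheory.MvPolynomial.Macaulay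

variable {n : ℕ}

/-! ## `ℒ_u`: the monomials of degree `d` lexicographically below `u` -/

/-- **`ℒ_u`** (Bruns–Herzog §4.2, before Lemma 4.2.5: "the monomials of degree `d` which are
'left' of `u`"), in the conventions of `MacaulayLexSegments.lean`: the exponent vectors of degree
`d` strictly below `u` for the lexicographic order with `x_0` most significant.
[cite: BrunsHerzog1998, §4.2 (definition before Lemma 4.2.5)] -/
def below (u : Fin n → ℕ) (d : ℕ) : Finset (Fin n → ℕ) :=
  (Mon n d).filter fun v => toLex v < toLex u

/-- Membership in `ℒ_u`. [cite: BrunsHerzog1998, §4.2 (definition before Lemma 4.2.5)] -/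
theorem mem_below {u v : Fin n → ℕ} {d : ℕ} : v ∈ below u d ↔ v ∈ Mon n d ∧ toLex v < toLex u :=
  mem_filter

/-- `ℒ_u ⊆ Mon_d`. [folklore] -/
private theorem below_subset_Mon (u : Fin n → ℕ) (d : ℕ) : below u d ⊆ Mon n d :=
  filter_subset _ _

/-- The lexicographic order splits along the first (most significant) coordinate. [folklore] -/
private theorem toLex_cons_lt_cons_iff {c c' : ℕ} {b b' : Fin n → ℕ} :
    toLex (Fin.cons c b : Fin (n + 1) → ℕ) < toLex (Fin.cons c' b' : Fin (n + 1) → ℕ) ↔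
      c < c' ∨ (c = c' ∧ toLex b < toLex b') := by
  rw [lex_lt_iff, lex_lt_iff]
  constructor
  · rintro ⟨i, heq, hlt⟩
    refine Fin.cases ?_ (fun i' => ?_) i heq hlt
    · intro _ hlt
      exact Or.inl (by simpa using hlt)
    · intro heq hlt
      right
      refine ⟨by simpa using heq 0 (Fin.succ_pos i'), i', fun j hj => ?_, by simpa using hlt⟩
      simpa using heq j.succ (Fin.succ_lt_succ_iff.mpr hj)
  · rintro (hlt | ⟨rfl, i', heq, hlt⟩)
    · exact ⟨0, fun j hj => absurd hj (Fin.not_lt_zero j), by simpa using hlt⟩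
    · refine ⟨i'.succ, fun j hj => ?_, by simpa using hlt⟩
      refine Fin.cases (by simp) (fun j' hj' => ?_) j hj
      simpa using heq j' (Fin.succ_lt_succ_iff.mp hj')

/-- **First-coordinate recursion for `|ℒ_u|`**: for `u = (c₀, u')` of degree `d`,
`|ℒ_u| = Σ_{c < c₀} #Mon_{d-c}(n) + |ℒ_{u'}|` (the monomials with a smaller `x_0`-exponent, and
those with the same `x_0`-exponent and a smaller tail). [cite: BrunsHerzog1998, §4.2 (natural decomposition of `ℒ_u`)] -/
theorem card_below_cons (c₀ : ℕ) (u' : Fin n → ℕ) {d : ℕ} (hc : c₀ ≤ d) :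
    (below (Fin.cons c₀ u' : Fin (n + 1) → ℕ) d).card =
      (∑ c ∈ range c₀, (Mon n (d - c)).card) + (below u' (d - c₀)).card := by
  classical
  have h := Literature.RingTheory.MvPolynomial.card_antidiagonalTuple_succ_filter_eq_sum n d
    {v : Fin (n + 1) → ℕ | toLex v < toLex (Fin.cons c₀ u' : Fin (n + 1) → ℕ)}
  change (below (Fin.cons c₀ u' : Fin (n + 1) → ℕ) d).card = _ at h
  rw [h, ← Finset.sum_range_add_sum_Ico _ (show c₀ ≤ d + 1 by omega),
    Finset.sum_eq_sum_Ico_succ_bot (show c₀ < d + 1 by omega)]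
  -- `c < c₀`: every tail qualifies; `c = c₀`: the tails below `u'`; `c > c₀`: none
  rw [Finset.sum_eq_zero (s := Ico (c₀ + 1) (d + 1)) fun c hc => by
    rw [card_eq_zero, filter_eq_empty_iff]
    intro b _
    simp only [Set.mem_setOf_eq, toLex_cons_lt_cons_iff, not_or, not_and]
    have := (mem_Ico.mp hc).1
    exact ⟨by omega, fun h => by omega⟩, add_zero]
  congr 1
  · refine Finset.sum_congr rfl fun c hc => ?_
    have hc' := mem_range.mp hc
    congr 1
    exact filter_true_of_mem fun b _ => by
      simp only [Set.mem_setOf_eq, toLex_cons_lt_cons_iff]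
      exact Or.inl hc'
  · unfold below
    congr 1
    exact filter_congr fun b _ => by
      simp only [Set.mem_setOf_eq, toLex_cons_lt_cons_iff, lt_irrefl, false_or, true_and]

/-- The last unit vector in `n + 2` variables is `(0, e_last)`. [folklore] -/
private theorem e_last_eq_cons (n : ℕ) :
    (e (Fin.last (n + 1)) : Fin (n + 2) → ℕ) = Fin.cons 0 (e (Fin.last n)) := by
  funext i
  refine Fin.cases ?_ (fun i' => ?_) i
  · simp
  · simp only [Fin.cons_succ, e_apply, Fin.ext_iff, Fin.val_succ, Fin.val_last]
    by_cases h : (i' : ℕ) = n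
    · rw [if_pos (by omega), if_pos h]
    · rw [if_neg (by omega), if_neg h]

/-- Multiplying `(c, u)` by the last variable multiplies the tail. [folklore] -/
private theorem cons_add_e_last (c : ℕ) (u : Fin (n + 1) → ℕ) :
    (Fin.cons c u : Fin (n + 2) → ℕ) + e (Fin.last (n + 1)) = Fin.cons c (u + e (Fin.last n)) := by
  rw [e_last_eq_cons]
  funext i
  refine Fin.cases ?_ (fun i' => ?_) i <;> simp

/-- In one variable there is nothing below. [folklore] -/
private theorem below_fin_one (u : Fin 1 → ℕ) (d : ℕ) (hu : u ∈ Mon 1 d) : below u d = ∅ := by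
  rw [below, filter_eq_empty_iff]
  intro v hv hlt
  obtain ⟨i, -, hi⟩ := lex_lt_iff.mp hlt
  have hv' := mem_Mon.mp hv
  have hu' := mem_Mon.mp hu
  rw [Fin.sum_univ_one] at hv' hu'
  have : i = 0 := Subsingleton.elim _ _
  subst this
  omega

/-- Reindexing `Σ_{c < c₀} f(d - c) = Σ_{i ∈ [d - c₀ + 1, d]} f(i)` (`c₀ ≤ d`). [folklore] -/
private theorem sum_range_reflect_Icc {c₀ d : ℕ} (hc : c₀ ≤ d) (f : ℕ → ℕ) :
    ∑ c ∈ range c₀, f (d - c) = ∑ i ∈ Icc (d - c₀ + 1) d, f i := by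
  induction c₀ with
  | zero => simp
  | succ c₀ ih =>
    rw [Finset.sum_range_succ, ih (by omega), show d - (c₀ + 1) + 1 = d - c₀ by omega,
      ← Finset.insert_Icc_add_one_left_eq_Icc (show d - c₀ ≤ d by omega), Finset.sum_insert (by simp),
      add_comm]

/-- **The Macaulay representation of `|ℒ_u|` and Prop. 4.2.8** (induction on the number of
variables): for `u ∈ Mon_d` in `n + 1` variables there is a `d`-th Macaulay representation `k` of
`|ℒ_u|` with `k(i) ≤ i + n - 1`, and `|ℒ_{u · x_n}| = Σ C(k(i) + 1, i + 1)`.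
[cite: BrunsHerzog1998, Prop. 4.2.8 (proof: natural decomposition)] -/
theorem exists_isRep_card_below (n : ℕ) : ∀ (d : ℕ) (u : Fin (n + 1) → ℕ), u ∈ Mon (n + 1) d →
    ∃ k : ℕ → ℕ, IsRep d (below u d).card k ∧ (∀ i, 1 ≤ i → i ≤ d → k i ≤ i + n - 1) ∧
      (below (u + e (Fin.last n)) (d + 1)).card = ∑ i ∈ Icc 1 d, (k i + 1).choose (i + 1) := by
  induction n with
  | zero =>
    intro d u hu
    refine ⟨fun i => i - 1, ⟨fun i hi hid => show i - 1 < i + 1 - 1 by omega, ?_⟩,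
      fun i hi hid => show i - 1 ≤ i + 0 - 1 by omega, ?_⟩
    · rw [below_fin_one u d hu, card_empty]
      exact Finset.sum_eq_zero fun i hi => by
        dsimp only
        exact Nat.choose_eq_zero_of_lt (by have := (mem_Icc.mp hi).1; omega)
    · rw [below_fin_one _ (d + 1) (add_e_mem_Mon hu _), card_empty]
      exact (Finset.sum_eq_zero fun i hi => by
        dsimp only
        exact Nat.choose_eq_zero_of_lt (by have := (mem_Icc.mp hi).1; omega)).symm
  | succ n ih =>
    intro d u hu
    -- split off the first coordinate
    set c₀ := u 0 with hc₀
    set u' : Fin (n + 1) → ℕ := Fin.tail u with hu'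
    have hu_eq : u = Fin.cons c₀ u' := (Fin.cons_self_tail u).symm
    have hsum := mem_Mon.mp hu
    rw [Fin.sum_univ_succ] at hsum
    have hc₀d : c₀ ≤ d := by rw [← hsum]; exact Nat.le_add_right _ _
    have hu'Mon : u' ∈ Mon (n + 1) (d - c₀) := by
      have : ∑ i : Fin (n + 1), u' i = ∑ i : Fin (n + 1), u i.succ := rfl
      rw [mem_Mon, this]; omega
    obtain ⟨k', hk', hbound', hup'⟩ := ih (d - c₀) u' hu'Mon
    -- reflections of the two sums over `c < c₀`
    have hrefl : ∑ c ∈ range c₀, (Mon (n + 1) (d - c)).card =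
        ∑ i ∈ Icc (d - c₀ + 1) d, (Mon (n + 1) i).card :=
      sum_range_reflect_Icc hc₀d fun x => (Mon (n + 1) x).card
    have hrefl' : ∑ c ∈ range c₀, (Mon (n + 1) (d + 1 - c)).card =
        ∑ i ∈ Icc (d + 1 - c₀ + 1) (d + 1), (Mon (n + 1) i).card :=
      sum_range_reflect_Icc (show c₀ ≤ d + 1 by omega) fun x => (Mon (n + 1) x).card
    -- the representation: `k'` on `[1, d - c₀]`, then `i + n` on `(d - c₀, d]`
    let k : ℕ → ℕ := fun i => if i ≤ d - c₀ then k' i else i + n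
    have hk_low : ∀ i, i ≤ d - c₀ → k i = k' i := fun i hi => by simp only [k, if_pos hi]
    have hk_top : ∀ i, d - c₀ < i → k i = i + n := fun i hi => by
      simp only [k, if_neg (show ¬i ≤ d - c₀ by omega)]
    refine ⟨k, ⟨fun i hi hid => ?_, ?_⟩, fun i hi hid => ?_, ?_⟩
    · by_cases h1 : i + 1 ≤ d - c₀
      · rw [hk_low i (by omega), hk_low (i + 1) h1]; exact hk'.lt i hi (by omega)
      · by_cases h2 : i ≤ d - c₀
        · rw [hk_low i h2, hk_top (i + 1) (by omega)]; have := hbound' i hi h2; omega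
        · rw [hk_top i (by omega), hk_top (i + 1) (by omega)]; omega
    · -- the value
      rw [GradedAlgebra.Macaulay.val, sum_Icc_split' (show d - c₀ ≤ d by omega), hu_eq,
        card_below_cons c₀ u' hc₀d, hrefl, add_comm]
      congr 1
      · refine Finset.sum_congr rfl fun i hi => ?_
        rw [hk_top i (by have := (mem_Icc.mp hi).1; omega), card_Mon,
          show n + 1 + i - 1 = i + n by omega]
      · rw [← hk'.val_eq, GradedAlgebra.Macaulay.val]
        exact Finset.sum_congr rfl fun i hi => by rw [hk_low i (mem_Icc.mp hi).2]
    · by_cases h2 : i ≤ d - c₀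
      · rw [hk_low i h2]; have := hbound' i hi h2; omega
      · rw [hk_top i (by omega)]; omega
    · -- `|ℒ_{u x_{n+1}}|`: same first coordinate, tail `u' x_n`
      rw [hu_eq, cons_add_e_last, card_below_cons c₀ _ (show c₀ ≤ d + 1 by omega),
        show d + 1 - c₀ = d - c₀ + 1 by omega, hup', hrefl',
        sum_Icc_split' (show d - c₀ ≤ d by omega), add_comm]
      congr 1
      · exact Finset.sum_congr rfl fun i hi => by rw [hk_low i (mem_Icc.mp hi).2]
      · rw [show d + 1 - c₀ + 1 = (d - c₀ + 1) + 1 by omega, ← Finset.map_add_right_Icc,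
          Finset.sum_map]
        refine Finset.sum_congr rfl fun i hi => ?_
        have hi1 := (mem_Icc.mp hi).1
        simp only [addRightEmbedding_apply]
        rw [hk_top i (by omega), card_Mon]
        congr 1; omega
where
  /-- splitting `[1, d]` at `j` -/
  sum_Icc_split' {j d : ℕ} (hjd : j ≤ d) (g : ℕ → ℕ) :
      ∑ r ∈ Icc 1 d, g r = (∑ r ∈ Icc 1 j, g r) + ∑ r ∈ Icc (j + 1) d, g r := by
    rw [← Finset.sum_union]
    · congr 1
      ext r; simp only [mem_Icc, mem_union]; omega
    · rw [Finset.disjoint_left]; intro r h1 h2; simp only [mem_Icc] at h1 h2; omega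

/-- **Bruns–Herzog, Prop. 4.2.8** (with Lemma 4.2.5), in the conventions of
`MacaulayLexSegments.lean`: `|ℒ_{u · x_{last}}| = |ℒ_u|^⟨d⟩` for `u ∈ Mon_d`.
[cite: BrunsHerzog1998, Prop. 4.2.8] -/
theorem card_below_add_e_last {d : ℕ} {u : Fin (n + 1) → ℕ} (hu : u ∈ Mon (n + 1) d) :
    (below (u + e (Fin.last n)) (d + 1)).card = upper d (below u d).card := by
  obtain ⟨k, hk, -, hup⟩ := exists_isRep_card_below n d u hu
  rw [hup, hk.upper_eq]

/-! ## Lex segments: the complement of the shadow (Bruns–Herzog Lemma 4.2.5, Cor. 4.2.9) -/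

/-- The lexicographic order is translation invariant. [folklore] -/
private theorem toLex_add_lt_add_right {a b : Fin n → ℕ} (h : toLex a < toLex b) (c : Fin n → ℕ) :
    toLex (a + c) < toLex (b + c) := by
  obtain ⟨i, heq, hlt⟩ := lex_lt_iff.mp h
  exact lex_lt_iff.mpr ⟨i, fun j hj => by simp [heq j hj], by simpa using hlt⟩

/-- `u · x_{last} ≤ u · x_i` in the lexicographic order (`x_0` most significant). [folklore] -/
private theorem toLex_add_e_last_le (u : Fin (n + 1) → ℕ) (i : Fin (n + 1)) :
    toLex (u + e (Fin.last n)) ≤ toLex (u + e i) := by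
  by_cases h : i = Fin.last n
  · rw [h]
  · refine le_of_lt (lex_lt_iff.mpr ⟨i, fun j hj => ?_, ?_⟩)
    · have hj1 : j ≠ i := hj.ne
      have hj2 : j ≠ Fin.last n := by
        intro hjl
        have hle := Fin.le_last i
        rw [hjl] at hj
        exact (hj.trans_le hle).false
      simp [hj1, hj2]
    · simp [h]

/-- **The complement of a non-empty lex segment is `ℒ_u`**, `u` its least element.
[cite: BrunsHerzog1998, §4.2 (before Lemma 4.2.5: `ℒ_u` and `ℛ_u`)] -/
theorem sdiff_eq_below_of_isLexSeg {L : Finset (Fin n → ℕ)} {d : ℕ} (hL : IsLexSeg L d)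
    {u : Fin n → ℕ} (hu : u ∈ L) (hmin : ∀ v ∈ L, toLex u ≤ toLex v) : Mon n d \ L = below u d := by
  ext v
  rw [mem_sdiff, mem_below]
  constructor
  · rintro ⟨hv, hvL⟩
    refine ⟨hv, lt_of_not_ge fun hle => hvL ?_⟩
    rcases hle.lt_or_eq with hlt | heq
    · exact hL.2 hu hv hlt
    · exact (toLex.injective heq) ▸ hu
  · rintro ⟨hv, hlt⟩
    exact ⟨hv, fun hvL => absurd (hmin v hvL) (not_le.mpr hlt)⟩

/-- **Lemma 4.2.5: the shadow of a lex segment `ℛ_u` is `ℛ_{u · x_{last}}`**; stated for the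
complements: `Mon_{d+1} ∖ ∇L = ℒ_{u · x_{last}}`. [cite: BrunsHerzog1998, Lemma 4.2.5] -/
theorem sdiff_shadow_eq_below_of_isLexSeg {L : Finset (Fin (n + 1) → ℕ)} {d : ℕ}
    (hL : IsLexSeg L d) {u : Fin (n + 1) → ℕ} (hu : u ∈ L) (hmin : ∀ v ∈ L, toLex u ≤ toLex v) :
    Mon (n + 1) (d + 1) \ shadow L = below (u + e (Fin.last n)) (d + 1) := by
  have hS := isLexSeg_shadow hL
  refine sdiff_eq_below_of_isLexSeg hS (add_e_mem_shadow hu _) fun w hw => ?_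
  obtain ⟨v, hv, i, rfl⟩ := mem_shadow.1 hw
  calc toLex (u + e (Fin.last n)) ≤ toLex (u + e i) := toLex_add_e_last_le u i
    _ ≤ toLex (v + e i) := by
        rcases (hmin v hv).lt_or_eq with hlt | heq
        · exact (toLex_add_lt_add_right hlt _).le
        · rw [toLex.injective heq]

/-- **Cor. 4.2.9 (the count): for a lex segment `L ⊆ Mon_d`, `d ≥ 1`,
`#Mon_{d+1} - #∇L = (#Mon_d - #L)^⟨d⟩`** (in `n + 1 ≥ 1` variables).
[cite: BrunsHerzog1998, Cor. 4.2.9] -/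
theorem card_Mon_succ_sub_card_shadow {d : ℕ} (hd : 1 ≤ d) {L : Finset (Fin (n + 1) → ℕ)}
    (hL : IsLexSeg L d) :
    (Mon (n + 1) (d + 1)).card - (shadow L).card = upper d ((Mon (n + 1) d).card - L.card) := by
  rcases L.eq_empty_or_nonempty with rfl | hne
  · -- `#Mon_{d+1} = (#Mon_d)^⟨d⟩`: the representation of `C(d + n, d)` is the single term `k(d) = d + n`
    have hsh : shadow (∅ : Finset (Fin (n + 1) → ℕ)) = ∅ := by simp [shadow]
    rw [hsh, card_empty, Nat.sub_zero, Nat.sub_zero, card_Mon, card_Mon]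
    let k : ℕ → ℕ := fun i => if i = d then d + n else i - 1
    have hk_d : k d = d + n := by simp only [k, if_true]
    have hk_lt : ∀ i, i ≠ d → k i = i - 1 := fun i hi => by simp only [k, if_neg hi]
    have hrep : IsRep d ((n + 1 + d - 1).choose d) k := by
      refine ⟨fun i hi hid => ?_, ?_⟩
      · rw [hk_lt i (by omega)]
        by_cases h : i + 1 = d
        · rw [h, hk_d]; omega
        · rw [hk_lt _ h]; omega
      · obtain ⟨d₀, rfl⟩ : ∃ d₀, d = d₀ + 1 := ⟨d - 1, by omega⟩
        rw [val_succ, hk_d, show n + 1 + (d₀ + 1) - 1 = d₀ + 1 + n by omega,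
          GradedAlgebra.Macaulay.val, Finset.sum_eq_zero fun i hi => by
            rw [hk_lt i (by have := (mem_Icc.mp hi).2; omega)]
            exact Nat.choose_eq_zero_of_lt (by have := (mem_Icc.mp hi).1; omega), add_zero]
    rw [hrep.upper_eq]
    obtain ⟨d₀, rfl⟩ : ∃ d₀, d = d₀ + 1 := ⟨d - 1, by omega⟩
    rw [Finset.sum_Icc_succ_top (by omega), hk_d, Finset.sum_eq_zero fun i hi => by
      rw [hk_lt i (by have := (mem_Icc.mp hi).2; omega)]
      exact Nat.choose_eq_zero_of_lt (by have := (mem_Icc.mp hi).1; omega), zero_add]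
    congr 1; omega
  · -- `u` the least element of `L`
    obtain ⟨u, hu, hmin⟩ := exists_min_image L (fun x => toLex x) hne
    have hM : (Mon (n + 1) d).filter (· ∈ L) = L := by
      ext v; simp only [mem_filter, and_iff_right_iff_imp]; exact fun h => hL.1 h
    rw [← card_sdiff_of_subset (shadow_subset_Mon hL.1), ← card_sdiff_of_subset hL.1,
      sdiff_shadow_eq_below_of_isLexSeg hL hu hmin, sdiff_eq_below_of_isLexSeg hL hu hmin]
    exact card_below_add_e_last (hL.1 hu)

/-! ## Macaulay's bound for monomial ideals (upper sets of exponents) -/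

/-- The exponent vectors of degree `d` in an upper set `E`, transported to `Mon N d`. [folklore] -/
private def monDeg (N : ℕ) (E : Set (Fin N →₀ ℕ)) (d : ℕ) [DecidablePred (· ∈ E)] :
    Finset (Fin N → ℕ) :=
  (Mon N d).filter fun a => Finsupp.equivFunOnFinite.symm a ∈ E

/-- `Mon N d` is the image of Mathlib's `finsuppAntidiag`. [folklore] -/
private theorem Mon_eq_map (N d : ℕ) :
    Mon N d = ((univ : Finset (Fin N)).finsuppAntidiag d).map Finsupp.equivFunOnFinite.toEmbedding := by
  ext u
  simp only [mem_map_equiv, mem_finsuppAntidiag, mem_Mon]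
  constructor
  · intro hu
    exact ⟨by simpa [Finsupp.equivFunOnFinite] using hu, subset_univ _⟩
  · rintro ⟨hu, -⟩
    simpa [Finsupp.equivFunOnFinite] using hu

/-- The transport preserves cardinalities. [folklore] -/
private theorem card_monDeg (N : ℕ) (E : Set (Fin N →₀ ℕ)) (d : ℕ) [DecidablePred (· ∈ E)] :
    (monDeg N E d).card = (((univ : Finset (Fin N)).finsuppAntidiag d).filter (· ∈ E)).card := by
  rw [monDeg, Mon_eq_map, Finset.filter_map, card_map]
  congr 1
  exact filter_congr fun a _ => by simp

/-- `E_{d+1} ⊇ ∇E_d` for an upper set `E`. [folklore] -/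
private theorem shadow_monDeg_subset {N : ℕ} {E : Set (Fin N →₀ ℕ)} (hE : IsUpperSet E) (d : ℕ)
    [DecidablePred (· ∈ E)] : shadow (monDeg N E d) ⊆ monDeg N E (d + 1) := by
  intro w hw
  obtain ⟨a, ha, i, rfl⟩ := mem_shadow.1 hw
  rw [monDeg, mem_filter] at ha ⊢
  refine ⟨add_e_mem_Mon ha.1 i, hE ?_ ha.2⟩
  intro j
  simp [Finsupp.equivFunOnFinite]

open Literature.RingTheory.HilbertSamuel in
/-- **Macaulay's bound for monomial ideals**: for an upper set `E ⊆ ℕ^N` of exponents (the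
monomial ideal `⟨X^a : a ∈ E⟩`) and `d ≥ 1`, `F(E)(d + 1) ≤ F(E)(d)^⟨d⟩`, where
`F(E)(d) = #Mon_d - #E_d`. (Leading terms not needed: `E_{d+1} ⊇ ∇E_d`, Macaulay's theorem on
lex segments, and Cor. 4.2.9.) [cite: BrunsHerzog1998, Thm. 4.2.10 with Cor. 4.2.9] -/
theorem upperSetHilbertFun_succ_le_upper (N : ℕ) (E : UpperSet (Fin N →₀ ℕ)) {d : ℕ} (hd : 1 ≤ d) :
    upperSetHilbertFun N E (d + 1) ≤ upper d (upperSetHilbertFun N E d) := by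
  classical
  rcases Nat.eq_zero_or_pos N with rfl | hN
  · -- no variables: nothing in positive degree
    simp [upperSetHilbertFun]
  · obtain ⟨n, rfl⟩ : ∃ n, N = n + 1 := ⟨N - 1, by omega⟩
    -- transport to `Mon`
    have hF : ∀ t, upperSetHilbertFun (n + 1) E t =
        (Mon (n + 1) t).card - (monDeg (n + 1) (E : Set (Fin (n + 1) →₀ ℕ)) t).card := by
      intro t
      rw [upperSetHilbertFun, card_monDeg, Mon_eq_map, card_map]
      congr 2
    rw [hF, hF]
    set A := monDeg (n + 1) (E : Set (Fin (n + 1) →₀ ℕ)) d with hA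
    have hAd : A ⊆ Mon (n + 1) d := filter_subset _ _
    -- a lex segment of the size of `A`
    obtain ⟨L, hL, hcard⟩ := exists_isLexSeg_card_eq d A.card (card_le_card hAd)
    calc (Mon (n + 1) (d + 1)).card - (monDeg (n + 1) (E : Set (Fin (n + 1) →₀ ℕ)) (d + 1)).card
        ≤ (Mon (n + 1) (d + 1)).card - (shadow A).card :=
          Nat.sub_le_sub_left (card_le_card (shadow_monDeg_subset E.upper d)) _
      _ ≤ (Mon (n + 1) (d + 1)).card - (shadow L).card :=
          Nat.sub_le_sub_left (card_shadow_le_of_isLexSeg hL hAd hcard.le) _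
      _ = upper d ((Mon (n + 1) d).card - L.card) := card_Mon_succ_sub_card_shadow hd hL
      _ = upper d ((Mon (n + 1) d).card - A.card) := by rw [hcard]

/-! ## Macaulay's theorem for homogeneous ideals -/

open Literature.RingTheory.HilbertSamuel in
/-- **Macaulay's theorem (Bruns–Herzog Thm. 4.2.10, (a) ⇒ (c)): for a homogeneous ideal `I` of
`K[X_0, …, X_{N-1}]` over any field `K` and `d ≥ 1`, the Hilbert function of `R = S/I` satisfies
`H(R, d + 1) ≤ H(R, d)^⟨d⟩`.** Via the leading-exponent monomial ideal (`H(S/I) = F(E(I))`)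
and `upperSetHilbertFun_succ_le_upper`. [cite: BrunsHerzog1998, Thm. 4.2.10] -/
theorem hilbertFunQuot_succ_le_upper {K : Type*} [Field K] {N : ℕ}
    {I : Ideal (_root_.MvPolynomial (Fin N) K)} (hI : IsHomogeneousIdeal I) {d : ℕ} (hd : 1 ≤ d) :
    hilbertFunQuot K N I (d + 1) ≤ upper d (hilbertFunQuot K N I d) := by
  rw [hilbertFunQuot_eq_upperSetHilbertFun MonomialOrder.lex hI]
  exact upperSetHilbertFun_succ_le_upper N _ hd

end Literature.RingTheory.MvPolynomial.Macaulay

end
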